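import Summits.SmoothPoincare4.SmoothPoincare4.Theses.ConvexBisection
import Literature.Topology.FourManifolds.SimpleBranchedCover
import Literature.Topology.FourManifolds.ClosedSurfaceBraid
import Literature.Topology.FourManifolds.HomotopyS4CompactProofs
import HarnessLib

/-!
# Line `branch-two-knot-quotient` for crux `ConvexBisection.AcyclicBisectionRigidity`
(item stmt-SmoothPoincare4-10507, route `route-SmoothPoincare4-ConvexBisection`, rank 2)

Skeleton (crux-plan, planner-cruxplan-stmt-SmoothPoincare4-10507-branch-two-knot-quot-0, 2026-08-16,
round 2) of the crux idea `Cruxes/AcyclicBisectionRigidity/Ideas/branch-two-knot-quotient.md`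
(ideator 6; triage TRIAGE-r2-1/2/3: pass ×3, merged with `folded-curve-branch-locus` whose surviving
content is this card's target), sharpened by the three triage notes and re-typed over the Literature
vocabulary that landed the same night for the sibling crux's line
`Cruxes/AcyclicBisectionExists/Lines/braided-branch-locus` (`IsSimpleBranchedCover`,
`IsSortedClosedSurfaceBraid`, fixed braid coordinates `SurfaceBraid.*` on `S⁴ ⊂ ℂ_z × ℂ_w × ℝ_t`).

THE CRUX. For every Hausdorff second-countable `C^∞` 4-manifold `M ≃ₕ S⁴`: if `M = e₁(W₁) ∪ e₂(W₂)`
for two smoothly embedded compact Stein domains meeting exactly along the images of their boundaries,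
with the complex tangencies pushed forward to ONE plane field on the seam and both halves ℚ-acyclic in
positive degrees, then `M ≅ S⁴`.

THE LEVER (card). DESCEND THE GLUED MANIFOLD TO A BRANCH LOCUS IN THE STANDARD `S⁴` and decide `M`
there: both halves are simple branched covers of the two hemispherical 4-balls `B₊ = {t ≥ 0}`,
`B₋ = {t ≤ 0}` branched over POSITIVE braided surfaces (Loi–Piergallini arXiv:math/0002042 Thm 1 /
Prop 1.2; Rudolph), the common contact seam is the cover of the equatorial `S³` branched along ONE
transverse closed braid (Harvey–Kawamuro–Plamenevskaya arXiv:0712.1557), so `M` itself is a simple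
branched cover `p : M → S⁴ = B₊ ∪ B₋` whose branch locus is a SIGN-SORTED closed surface braid
`F ⊂ D²_z × S² ⊂ S⁴` (positive twist points north, negative south) with `p⁻¹(B₊) = e₁(W₁)`,
`p⁻¹(B₋) = e₂(W₂)` — the exact converse of the sibling line's `stub_pullbackSteinBisection`. In the
HYPERELLIPTIC sector (page `Σ₂(D², m)`, symmetric vanishing cycles on both sides, Birman–Hilden) the
degree is `2`, ℚ-acyclicity of a half ⇔ `m − 1` bands ⇔ the hemisphere `F ∩ B_±` is a DISC, and by
Smith theory (`M` a ℤ/2-homology sphere) `F` is a 2-KNOT `R`: `M = Σ₂(S⁴, R)`. The non-twin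
obstruction that killed all three round-1 lines is invisible downstairs: Hayden's exotic pair
(arXiv:2003.13681 Thm 1.3) descends to two inequivalent ribbon discs of ONE sphere `R_H = D ∪ D̄′`,
which is UNKNOTTED (equator re-choice, verified by all three triagers), so `M_H = Σ₂(S⁴, unknot) = S⁴`.

THE LINE (three registered stubs + one in-file theorem; composition `AcyclicBisectionRigidity_of`,
kernel-checked, no `sorry` of its own):
* `stub_braidDescent` — THE LEVER'S CONSTRUCTION (card K2 ∪ K3 = the "common presentation lemma";
  NOT SPC4-shielded: no `M ≃ₕ S⁴` hypothesis, refutable by one acyclic common-contact bisection that is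
  not a sorted branched cover with the halves as hemisphere preimages). Output: a degree `d ≥ 1`, a
  sorted closed surface braid `f : S → S⁴`, a simple `d`-fold cover `p : M → S⁴` with product tubes, and
  `range e₁ = p⁻¹(B₊)`, `range e₂ = p⁻¹(B₋)`. Degree `2` = hyperelliptic sector; `d ≥ 3` always
  available for each half separately (LP), the content is the COMMON presentation across the seam.
* `nonempty_diffeomorph_of_degree_one` — PROVED here: a degree-one simple cover has empty branch
  surface (two sheets merge at every ramification point) and is a bijective local diffeomorphism, hence
  a diffeomorphism `M ≅ S⁴` (`IsLocalDiffeomorph.diffeomorphOfBijective`). The seam-`S³` sector lands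
  here (both halves `B⁴`, trivial covering).
* `stub_twoKnotBranchedDoubleStandard` — THE TARGET (card K1, Gordon 1976's question for homotopy
  spheres): a homotopy 4-sphere that is a DOUBLE cover of `S⁴` branched along a closed surface (product
  tubes ⇒ orientable; Smith theory ⇒ a 2-knot) is `S⁴`. SPC4-implied (Disproof §1 shape), hence only
  provable; proper sub-statement (needs an involution) with four engines: `b(R) ≤ 3` (Meier–Zupan
  arXiv:1507.08370 Thm 1.8 ⇒ unknotted; independently the bridge-trisection lift `(b; cᵢ) ↦ (b−1; cᵢ−1)`
  ⇒ trisection genus `≤ 2` ⇒ tree fact `mz_genus_le_two_homotopySphere_gk`), braid index `≤ 3` ⇒ ribbon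
  (Kamada 1992) ⇒ `M = D(Σ₂(B⁴, ribbon disc))` a presentation sphere (item 3717's territory), `R`
  `S¹`-invariant / twist-spun ⇒ circle action ⇒ tree fact `fintushelPao_circleAction_homotopySphere_four`
  (calibration: `(S⁴, τ_{2j+1}K)` must come out standard with `R` KNOTTED — Pao 1978, Hillman p. 80),
  `R` unknotted ⇒ `Σ₂(S⁴, unknot) = S⁴` (Hayden's `R_H`, the positron sphere).
* `stub_sortedCoverStandard` — THE RESIDUAL (non-hyperelliptic sector, `d ≥ 3`; card K3's recogniser,
  triage: "no complexity engine"): a homotopy 4-sphere presented as a simple `d`-fold cover of `S⁴`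
  along a sign-sorted closed surface braid whose two hemisphere preimages are ℚ-acyclic is `S⁴`.
  SPC4-implied, only provable; one engine (the trisection lift: genus `≤ b(F) − d + 1`, so `b(F) ≤ d + 1`
  ⇒ standard); shared territory with the word-calculus line `hurwitz-deletion-presentation` (a sorted
  braided cover IS an achiral factorisation over `S²`) and, for planar pages (`d = k` sheets), with crux
  stmt-SmoothPoincare4-10511. Named as residual, not dressed as a lever.
* `AcyclicBisectionRigidity_of : ConvexBisection.AcyclicBisectionRigidity` — compactness and
  non-emptiness of `M` from `M ≃ₕ S⁴` (tree theorem `compactSpace_of_homotopyEquiv_sphere_four_holds`;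
  a point of `S⁴` pulled back), descent, then `d = 1` (in-file) | `d = 2` (target) | `d ≥ 3` (residual,
  after transporting ℚ-acyclicity of `Wᵢ` to `p⁻¹(B_±)` along `Wᵢ ≃ₜ range eᵢ = p⁻¹(B_±)`,
  `singularHomology.mapIso`).

DISPROOF.LEAN HONOURED (`Cruxes/AcyclicBisectionRigidity/Disproof.lean`, cdisprove gen 5 v17, read
2026-08-16, and the landed `Theorems/AcyclicBisectionRigidity/Negative/{LoadBearing,Targets,Transport,
DoubleSector,TwinDecomposition,SeamCompatible,RoundTwoLevers,HurwitzTypeCount}.lean`):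
`false_without_homotopyEquiv` — `H : M ≃ₕ S⁴` is used at `stub_twoKnotBranchedDoubleStandard` and
`stub_sortedCoverStandard` (the only stubs concluding `≅ S⁴` from cover data; without `H` the doubles
`D(B_{p,q})` descend to sorted covers with `π₁ ≠ 1`) and for compactness/non-emptiness in the
composition; the lever `stub_braidDescent` deliberately does NOT take `H` (it is a statement about all
acyclic common-contact bisections, hence refutable without an exotic sphere — Disproof §1
`shielded_of_spc4` does not cover it) but DOES take ℚ-acyclicity, the one conjunct separating the crux
from SPC4 (`collapse_without_acyclic`): equal numbers of positive and negative twist points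
`n₊ = n₋ = rank H₁(page)` ⇒ equal self-linking of the two equatorial braids, the first obstruction to a
common presentation, vanishes exactly by acyclicity. §2 junk: the empty manifold (two empty halves) would
refute a descent with `d ≥ 1` — excluded by `[Nonempty M]`, supplied from `H` in the composition.
§6/§9e/§12b and p71941/p74611/p74638/p75201 (twins, doubles, seam-compatibility): NO stub concludes a
diffeomorphism of the halves, a double, or seam-compatibility — `W₁ ≇ W₂` is expected (two braided
surfaces of one closed braid) and Hayden's witness is an INSTANCE on which the line outputs `S⁴`
(§13b concurs). §13a (`DoubleReduction` is a costume): no stub reduces to doubles. §13c/§13d (type-count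
kill of monotone word reduction; T6 torsion spheres): the line uses no word calculus; the `(P₅, φ₀)` pair
and the 324 T6 spheres are planar (`k = 5` sheets) hence land in `stub_sortedCoverStandard` (residual),
honestly outside the engines. §5b/§5d (`S³/Q₈`, `Y(p)`): genus-1 hyperelliptic data ⇒ `d = 2` with a
DISCONNECTED equatorial braid closure (triage r2-2: `|H₁| = 4` even forbids disc hemispheres), `R` still a
2-knot by Smith theory, `M = S⁴` consistent. Negatives index (`ledger negatives --problem
SmoothPoincare4`, 2026-08-16): 0 refuted statements; no landed Negative lemma has an instance among the
stubs.

LEAD c1 (prover-line-stmt-SmoothPoincare4-10507-c1-0, 2026-08-16; skeleton owned as a WORK FILE, not registered —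
the item's single skeleton slot is held by lead a1-1 on line seam-duality-cancellation). WAVE 1 (two stub-workers):
* `stub_braidDescent` — `stub-blocked: none`; AUDIT PASSES (not junk-false, not misstated: halves and seam are forced
  nonempty by `SteinStructure.boundary_eq` + `[Nonempty M]`; `[Nonempty M]` is necessary; no junk cover satisfies
  `card_fibre`/`dichotomy`; the tree instance `Disproof.acyclicBisection_sphere` is met by `d = 1`, `S = ∅`;
  orientation / χ / twist-count bookkeeping consistent; `e₁ ↔ north` symmetric under `t ↦ −t` via `diffeomorph_comp`).
  WHY BLOCKED: no named fact in the tree, proved or not, produces ANY branched covering of a Stein domain over `𝔻⁴`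
  or of `M` over `S⁴`; the needed inputs are ABSENT as vocabulary as much as as facts — (A) Loi–Piergallini 2001
  Thm 1 "⇐" + Prop 1.2 needs BOUNDED versions of `IsSimpleBranchedCover` / braided surfaces in `D² × D²`; (B) HKP
  §2.5: the boundary contact structure is supported by the lifted braid-axis open book (open-book lifting); (C) Giroux
  stabilisation, hard direction (`OpenBook.stabilise`); (D) liftable braids `L_q ↠ Mod(P,∂)` (Zuddas / Oba Lemma 3.1);
  and (E) THE STUB'S OWN CONTENT, unpublished: a COMMON quasipositive presentation of two positive factorisations of
  one monodromy with `#F₁ = #F₂` (what ℚ-acyclicity buys). Even with A–D as fact-stubs the lever reduces exactly to E.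
  Reshape available to a planner (not to a prover): Literature definition requests for the `∂`-versions of the two
  landed predicates, then fact-stubs A–D feeding a lever `stub_commonQuasipositivePresentation` (E).
* `stub_twoKnotBranchedDoubleStandard` — `stub-blocked: Literature.Barriers.SmoothPoincare4.mz_genus_le_two_homotopySphere_gk`
  (undischarged `def … : Prop`; engine (T) and only for `b(R) ≤ 3`); `fintushelPao_circleAction_homotopySphere_four`
  likewise undischarged and only for `S¹`-invariant `R`; Smith theory (branch surface of a degree-2 cover of a homotopy
  sphere is a 2-sphere) and `Σ₂(S⁴, unknot) ≅ S⁴` are absent. PROVED on the way (helper, proposal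
  `Theorems/ConvexBisectionAcyclicBisectionRigidityBranchNonemptyBranchSurface.lean`): the `S = ∅` reading is vacuous —
  `nonempty_branchSurface_of_degree_two` (a 2-sheeted covering of the simply connected `S⁴` by `M ≃ₕ S⁴` would have a
  global section, contradicting `card_fibre = 2`).
* `stub_sortedCoverStandard` — the residual (crux downstairs), not waved.
CROSS-LINE HELPER landed by this lead (serves the two cross-seam levers of the sibling lines and crux 4, not this line):
MORSE GLUING ACROSS THE SEAM — `SeamGluing.exists_isMorse_of_isBoundaryGluing` / `exists_isMorse_of_bisection`
(`Theorems/ConvexBisectionAcyclicBisectionRigiditySeamGluing*.lean`): a bisected closed manifold with adapted Morse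
functions on the halves carries a Morse function with `#Crit_i = c_i(f₁) + c_{4−i}(f₂)`.
-/

noncomputable section

open scoped Manifold ContDiff Topology ContinuousMap
open Set Function
open CategoryTheory.Limits
open Literature.Geometry.Symplectic Literature.AlgebraicTopology.SingularHomology
open Literature.Topology.FourManifolds

-- The namespace is prescribed by the crux protocol (`Summit.<P>.<Sub>.Cruxes.<Crux>.<Slug>` with
-- `P = Sub = SmoothPoincare4`), hence the duplicated component.
set_option linter.dupNamespace false
set_option linter.unusedVariables false

namespace Summit.SmoothPoincare4.SmoothPoincare4.Cruxes.AcyclicBisectionRigidity.BranchTwoKnotQuotient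

open Summit.SmoothPoincare4.SmoothPoincare4.Theses

/-- Local notation: `𝔼 n = ℝⁿ` (model space). -/
local notation "𝔼 " n:arg => EuclideanSpace ℝ (Fin n)

/-- Local notation: the round 4-sphere `S⁴ ⊂ ℝ⁵ = ℂ_z × ℂ_w × ℝ_t`, the carrier of the summit statement
and of the fixed braid coordinates of `Literature.Topology.FourManifolds.SurfaceBraid`. -/
local notation "𝕊⁴" => (Metric.sphere (0 : EuclideanSpace ℝ (Fin 5)) 1)

/-- A point of the round 4-sphere (to pull non-emptiness of `M` back along `M ≃ₕ S⁴`). -/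
def northPole : 𝕊⁴ :=
  ⟨EuclideanSpace.single 0 1, by simp⟩

/-! ## Stub 1 — the lever's construction: sorted branched-cover descent of the bisection -/

/-- **Stub 1 — BRAID DESCENT (card K2 `HyperellipticDescent` ∪ K3 `NonHyperellipticDescent`, the common
presentation lemma; THE LEVER'S CONSTRUCTIVE HALF; refutable, not SPC4-shielded).**
Let `M` be a compact nonempty Hausdorff second-countable `C^∞` 4-manifold (NO homotopy-sphere hypothesis)
covered by two smoothly embedded compact Stein domains `e₁ : (W₁, J₁) → M`, `e₂ : (W₂, J₂) → M` meeting
exactly along the images of their boundaries, with the complex tangencies pushed forward to one plane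
field on the seam, both halves ℚ-acyclic in positive degrees. Then `M` is a simple branched cover of the
standard `S⁴` SORTED BY THE EQUATOR: there are a degree `d ≥ 1`, a closed surface `S`, a sign-sorted
closed surface braid `f : S → S⁴` (positive twist points over the northern hemisphere of the base `S²`,
negative ones over the southern, exact Loi–Piergallini normal form `{w' − w'_c = (z − z_c)²}`), and a
simple `d`-fold branched covering `p : M → S⁴` along `F = f(S)` with product tubes `ν`, `σ`, such that
the two halves ARE the hemisphere preimages: `e₁(W₁) = p⁻¹{t ≥ 0}`, `e₂(W₂) = p⁻¹{t ≤ 0}`.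
Why plausibly true (paper route): (1) Akbulut–Ozbagci / Loi–Piergallini: `(Wᵢ, Jᵢ)` deforms to a PALF
whose boundary open book supports `ξᵢ = ξ_{Jᵢ}|∂Wᵢ`; the seam condition makes `ψ = e₂⁻¹ ∘ e₁|∂W₁` a
contactomorphism `(∂W₁, ξ₁) → (∂W₂, ξ₂)`, so `M = W₁ ∪_ψ W̄₂`; (2) Giroux: after a COMMON positive
stabilisation (realised by positive stabilisations of both PALFs, `Wᵢ` unchanged) `ψ` is isotopic to an
isomorphism of open books, absorbed into a collar: both halves are PALFs over ONE page `P` with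
monodromies `φ` and positive factorisations `F₁`, `F₂`; (3) LP §4 / Zuddas arXiv:0710.0102 / Oba
arXiv:1508.01020 Lemma 3.1: for a simple covering `q : P → D²` of degree `d ≥ 3` in standard position
the liftable braids surject onto `Mod(P, ∂)` and every vanishing cycle is the connected lift of an arc, so
each half is a `d`-fold cover of the bidisc `D²_z × D_±` branched over a positive braided surface with
`#Fᵢ` bands, glued to `p⁻¹(B_±)` by the unbranched collar piece over `S¹ × D³_±`; (4) THE CONTENT
(common presentation): the two equatorial braids `β₁ = ∏ σ_{a_j}`, `β₂ = ∏ σ_{a'_j} ∈ L_q` both lift to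
`φ`, and the closed surface braid over `S² = D₊ ∪ D₋` exists iff `β₁ = β₂` in `B_m`; `β₁β₂⁻¹` lies in
`ker(L_q → Mod(P,∂))` and must be absorbed by re-choosing lifting arcs, Hurwitz moves, conjugation by
liftable braids, stabilisation of the covering (`(d,m) ↦ (d+1,m+1)`) and common positive stabilisation of
both PALFs — the first obstruction, the exponent sum / self-linking `sl(β̂ᵢ) = #Fᵢ − m`, vanishes because
ℚ-ACYCLICITY forces `#F₁ = #F₂ = rank H₁(P)`. In the hyperelliptic sector (`q` of degree 2,
`P = Σ₂(D², m)`, all cycles symmetric: pages `T_{1,1}`, braid-lifted Hayden / positron / `S³/Q₈` data)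
Birman–Hilden makes `L_q = B_m → Mod(P,∂)` injective and step (4) is automatic with `d = 2`. Doubles
`D(W)` (Disproof §12) descend trivially (same presentation mirrored). The seam-`S³` sector gives `d = 1`
(`W₁ = W₂ = B⁴`, trivial covering, `S = ∅`). (5) Smoothing across the seam: both covers are products
over collars; re-choose the LP identification of `W₂` by a diffeomorphism fixing `∂W₂`.
Why it might fail: a positivity-compatible absorption of `ker(L_q → Mod(P,∂))` between two DIFFERENT
fillings is in no paper (LP/APZ arXiv:1104.4536 treat one filling; Piergallini–Zuddas covering moves
realise diffeomorphisms of covers of one manifold); an invariant of pairs of positive liftable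
factorisations with equal lifts, finer than exponent sum and stable under the moves, would kill it —
cheapest hunt: Oba's `X_{N,i}` (arXiv:1508.01020 Thm 1.1: distinct covers of `D⁴` along ONE braided
surface `S_N`, degree `3N − 1`) glued pairwise along their common `(L(2N,1), ξ)` boundaries.
NOT implied by SPC4 (it pins the hemisphere preimages to the GIVEN halves; false for `M = ∅`, hence
`[Nonempty M]`). Size XL (PALF / Giroux / liftable-braid vocabulary absent from the tree; `OpenBook`,
`Supports`, `SteinStructure`, `IsSimpleBranchedCover`, `IsSortedClosedSurfaceBraid` exist).
Sources: arXiv:math/0002042 (Thm 1, Prop 1.2, §4), arXiv:math/0012239, arXiv:0712.1557 §2.5,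
arXiv:math/9407217 (Kamada: Alexander/Markov in dimension four), arXiv:0710.0102, arXiv:1508.01020,
arXiv:1104.4536, arXiv:1602.07459, Giroux ICM 2002, Birman–Hilden 1973. -/
theorem stub_braidDescent :
    ∀ (M : Type) [TopologicalSpace M] [T2Space M] [SecondCountableTopology M] [CompactSpace M]
      [Nonempty M] [ChartedSpace (𝔼 4) M] [IsManifold (𝓡 4) ∞ M]
      (W₁ : Type) [TopologicalSpace W₁] [ChartedSpace (EuclideanHalfSpace 4) W₁]
      [IsManifold (𝓡∂ 4) ∞ W₁] [CompactSpace W₁] (W₂ : Type) [TopologicalSpace W₂]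
      [ChartedSpace (EuclideanHalfSpace 4) W₂] [IsManifold (𝓡∂ 4) ∞ W₂] [CompactSpace W₂]
      (J₁ : SteinStructure W₁) (J₂ : SteinStructure W₂) (e₁ : W₁ → M) (e₂ : W₂ → M),
    Manifold.IsSmoothEmbedding (𝓡∂ 4) (𝓡 4) ∞ e₁ → Manifold.IsSmoothEmbedding (𝓡∂ 4) (𝓡 4) ∞ e₂ →
    range e₁ ∪ range e₂ = univ →
    range e₁ ∩ range e₂ = e₁ '' (𝓡∂ 4).boundary W₁ →
    range e₁ ∩ range e₂ = e₂ '' (𝓡∂ 4).boundary W₂ →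
    (∀ w₁ w₂, e₁ w₁ = e₂ w₂ →
      Submodule.map (mfderiv (𝓡∂ 4) (𝓡 4) e₁ w₁).toLinearMap (contactPlane J₁.J w₁) =
        Submodule.map (mfderiv (𝓡∂ 4) (𝓡 4) e₂ w₂).toLinearMap (contactPlane J₂.J w₂)) →
    (∀ k, 0 < k → IsZero (singularHomology ℚ ℚ W₁ k) ∧ IsZero (singularHomology ℚ ℚ W₂ k)) →
    ∃ (d : ℕ) (S : Type) (_ : TopologicalSpace S) (_ : T2Space S) (_ : SecondCountableTopology S)
      (_ : CompactSpace S) (_ : ChartedSpace (𝔼 2) S) (_ : IsManifold (𝓡 2) ∞ S)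
      (f : S → 𝕊⁴) (ν : S × ℂ → 𝕊⁴) (σ : S × ℂ → M) (p : M → 𝕊⁴),
      1 ≤ d ∧ IsSimpleBranchedCover f ν σ p d ∧ IsSortedClosedSurfaceBraid S f ∧
      range e₁ = p ⁻¹' SurfaceBraid.northBall ∧ range e₂ = p ⁻¹' SurfaceBraid.southBall := by
  sorry

/-! ## Degree one: the cover is already a diffeomorphism (proved) -/

/-- **A simple branched cover of degree one has EMPTY branch surface**: at a point `s ∈ S` the two sheets
`σ(s, 1) ≠ σ(s, −1)` lie over the same point `ν(s, 1) ∉ F`, a fibre which the degree clause says has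
exactly one point. [folklore] -/
theorem isEmpty_branchSurface_of_degree_one
    {M : Type} [TopologicalSpace M] [ChartedSpace (𝔼 4) M]
    {S : Type} [TopologicalSpace S] [ChartedSpace (𝔼 2) S]
    {f : S → 𝕊⁴} {ν : S × ℂ → 𝕊⁴} {σ : S × ℂ → M} {p : M → 𝕊⁴}
    (h : IsSimpleBranchedCover f ν σ p 1) : IsEmpty S := by
  refine ⟨fun s => ?_⟩
  have hx : p (σ (s, 1)) ∉ range f := by
    rw [h.apply_ramTube_mem_range_iff]
    exact one_ne_zero
  have hfin : (p ⁻¹' {p (σ (s, 1))}).Finite := h.finite_fibre one_ne_zero hx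
  have hne : σ (s, 1) ≠ σ (s, -1) := by
    intro heq
    have h2 := congrArg Prod.snd (h.injective_ramTube heq)
    norm_num at h2
  have hlt : 1 < (p ⁻¹' {p (σ (s, 1))}).ncard :=
    (Set.one_lt_ncard hfin).2 ⟨σ (s, 1), rfl, σ (s, -1), h.apply_ramTube_neg s 1, hne⟩
  have hcard : (p ⁻¹' {p (σ (s, 1))}).ncard = 1 := by
    rw [← Nat.card_coe_set_eq]
    exact h.card_fibre _ hx
  omega

/-- **Degree-one simple branched covers are diffeomorphisms** (the seam-`S³` endpoint of the line, where
both halves are 4-balls and the Loi–Piergallini coverings are trivial): the branch surface is empty, so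
`p` is a local diffeomorphism everywhere (the dichotomy clause) and bijective (every fibre has exactly one
point), hence a diffeomorphism `M ≅ S⁴` (`IsLocalDiffeomorph.diffeomorphOfBijective`). [folklore] -/
theorem nonempty_diffeomorph_of_degree_one
    {M : Type} [TopologicalSpace M] [ChartedSpace (𝔼 4) M]
    {S : Type} [TopologicalSpace S] [ChartedSpace (𝔼 2) S]
    {f : S → 𝕊⁴} {ν : S × ℂ → 𝕊⁴} {σ : S × ℂ → M} {p : M → 𝕊⁴}
    (h : IsSimpleBranchedCover f ν σ p 1) : Nonempty (M ≃ₘ⟮𝓡 4, 𝓡 4⟯ 𝕊⁴) := by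
  haveI : IsEmpty S := isEmpty_branchSurface_of_degree_one h
  have hS : ∀ x : 𝕊⁴, x ∉ range f := fun x ⟨s, _⟩ => isEmptyElim s
  have hσ : ∀ y : M, y ∉ range σ := fun y ⟨⟨s, _⟩, _⟩ => isEmptyElim s
  have hloc : IsLocalDiffeomorph (𝓡 4) (𝓡 4) ∞ p := fun y =>
    (h.dichotomy y).resolve_right (hσ y)
  have hinj : Injective p := by
    intro y y' hyy'
    by_contra hne
    have hfin : (p ⁻¹' {p y'}).Finite := h.finite_fibre one_ne_zero (hS _)
    have hlt : 1 < (p ⁻¹' {p y'}).ncard :=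
      (Set.one_lt_ncard hfin).2 ⟨y, hyy', y', rfl, hne⟩
    have hcard : (p ⁻¹' {p y'}).ncard = 1 := by
      rw [← Nat.card_coe_set_eq]
      exact h.card_fibre _ (hS _)
    omega
  exact ⟨hloc.diffeomorphOfBijective ⟨hinj, h.surjective one_ne_zero⟩⟩

/-! ## Stub 2 — the target: homotopy-sphere double branched covers of `S⁴` are standard -/

/-- **Stub 2 — `TwoKnotBranchedDoubleStandard` (card K1; THE TARGET of the line; Gordon's 1976 question
restricted to homotopy spheres).** Let `M ≃ₕ S⁴` be a Hausdorff second-countable `C^∞` 4-manifold which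
is a simple DOUBLE branched covering `p : M → S⁴` of the standard 4-sphere along a closed embedded surface
`F = f(S)` with product tubes. Then `M ≅ S⁴`.
Bookkeeping the prover gets for free: `M` is a ℤ/2-homology 4-sphere, the deck involution
`σ(s, v) ↦ σ(s, −v)` has fixed set `≅ S`, so Smith theory (Bredon 1972 III §7: `Σ b_k(Fix; 𝔽₂) ≤ 2`,
`χ(Fix) ≡ χ(M)`; or directly `χ(M) = 4 − χ(F)` and `rank H₁(M; 𝔽₂) ≥ #π₀F − 1`) makes `F` a 2-SPHERE:
`M = Σ₂(S⁴, R)` for a 2-knot `R` (`TwoKnot` after reparametrising `S` by `S²`); no braid position is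
assumed (Viro–Kamada supply one by isotopy, transported by `IsSimpleBranchedCover.diffeomorph_comp`).
Why plausibly true / ENGINES (each closes a named sub-sector): (U) `R` unknotted ⇒ `M = Σ₂(S⁴, unknot)
= S⁴` (linear involution; contains Hayden's `M_H`: `R_H = D ∪_C D̄′` is unknotted by the equator
re-choice — TRIAGE-r2-1 (S1), r2-2, r2-3 — and the positron sphere); (T) BRIDGE-TRISECTION LIFT: a
`(b; c₁, c₂, c₃)`-bridge trisection of `R` (Meier–Zupan arXiv:1507.08370) lifts to a
`(b − 1; c₁ − 1, c₂ − 1, c₃ − 1)`-trisection of `M` (double covers of `c` trivial discs in `B⁴`, of `b`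
trivial arcs in `B³`, of `2b` points in `S²`), so trisection genus `≤ b(R) − 1` and `b(R) ≤ 3 ⇒ M ≅ S⁴`
by the tree fact `mz_genus_le_two_homotopySphere_gk` (independently MZ Thm 1.8: `b ≤ 3` ⇒ unknotted);
(Rib) braid index `≤ 3` ⇒ `R` ribbon (Kamada 1992) ⇒ `R = D″ ∪ D̄″` (Yanagawa) ⇒ `M = D(Σ₂(B⁴, D″))`,
a double of a ℚ-acyclic 2-handlebody — a presentation sphere when simply connected (item
stmt-SmoothPoincare4-3717's territory; Disproof §4b/§12); (S¹) `R` twist-spun / `S¹`-invariant ⇒ `M`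
inherits an effective circle action ⇒ `S⁴` by the tree fact `fintushelPao_circleAction_homotopySphere_four`
— CALIBRATION (triage r2-3 (O1), Hillman *2-Knots and their Groups* p. 80 after Pao 1978 / Plotnick):
`Σ₂(S⁴, τ_{2j+1}K) ≅ S⁴` with `τ_{2j+1}K` KNOTTED, non-ribbon, asymmetric, so the statement rightly does
NOT conclude "`R` unknotted". Open core: group-`ℤ` and higher-bridge branch knots (Conway–Powell
arXiv:1902.05321: ℤ-ribbon-disc pairs give group-`ℤ` spheres, TOP-unknotted by Freedman).
IMPLIED BY SPC4 (Disproof §1 `shielded_of_spc4`: shape `∀ M ≃ₕ S⁴, P M → M ≅ S⁴`), hence only provable,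
never refutable short of an exotic `S⁴`; NOT SPC4-equivalent (it needs the involution). `M ≃ₕ S⁴` is
load-bearing (`false_without_homotopyEquiv`): `Σ₂(S⁴, τ₂K)` is not simply connected for `K` non-trivial (card; Plotnick's fibred covers, the
fibre being `Σ₂(S³,K)° ≠ B³`), and `Σ₂(S⁴, T²_{unknotted}) = S² × S²` (the quotient of `ℂP¹ × ℂP¹` by
`conj × conj` is `S⁴`) is simply connected but no sphere. Size XL / open-problem at the core; the four
engines are each L–XL formal targets.
Sources: Gordon, Comment. Math. Helv. 51 (1976) 585–596; Pao, Topology 17 (1978) 291–296; Plotnick 1984;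
Akbulut–Kirby, Math. Ann. 252 (1980) 111–131 (doi:10.1007/bf01420118); arXiv:1507.08370 Thm 1.8;
arXiv:1410.8133; Kamada, J. Knot Theory Ramif. 1 (1992) 137–160; arXiv:2003.13681; arXiv:2107.06856;
arXiv:1902.05321; tree `Literature/Barriers/SmoothPoincare4/{LowGenusTrisectionsStandard,
CircleActionsStandard,TwistedSpheresStandard}.lean`. -/
theorem stub_twoKnotBranchedDoubleStandard :
    ∀ (M : Type) [TopologicalSpace M] [T2Space M] [SecondCountableTopology M]
      [ChartedSpace (𝔼 4) M] [IsManifold (𝓡 4) ∞ M],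
      M ≃ₕ 𝕊⁴ →
    ∀ (S : Type) [TopologicalSpace S] [T2Space S] [SecondCountableTopology S] [CompactSpace S]
      [ChartedSpace (𝔼 2) S] [IsManifold (𝓡 2) ∞ S]
      (f : S → 𝕊⁴) (ν : S × ℂ → 𝕊⁴) (σ : S × ℂ → M) (p : M → 𝕊⁴),
      IsSimpleBranchedCover f ν σ p 2 →
      Nonempty (M ≃ₘ⟮𝓡 4, 𝓡 4⟯ 𝕊⁴) := by
  sorry

/-! ## Stub 3 — the residual: sorted covers of higher degree (non-hyperelliptic sector) -/

/-- **Stub 3 — `SortedCoverStandard` (card K3's recogniser; THE RESIDUAL, non-hyperelliptic sector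
`d ≥ 3`).** Let `M ≃ₕ S⁴` be a Hausdorff second-countable `C^∞` 4-manifold presented as a simple branched
cover `p : M → S⁴` of degree `d ≥ 3` along a SIGN-SORTED closed surface braid `F = f(S)` (product tubes),
whose two hemisphere preimages `p⁻¹{t ≥ 0}`, `p⁻¹{t ≤ 0}` are ℚ-acyclic in positive degrees. Then
`M ≅ S⁴`. Dictionary: this is the crux read downstairs on the sector the lever does not shrink — by the
sibling line's (KNOWN, Loi–Piergallini Thm 2.2) `stub_pullbackSteinBisection` the hemisphere preimages ARE
an acyclic common-contact Stein bisection of `M`, an achiral Lefschetz-type presentation over `S²` with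
fibre `P` (the `d`-fold cover of `D²_z`), `n₊ = n₋ = rank H₁(P)` sorted twist points; planar pages are
`d = k`-sheeted (crux stmt-SmoothPoincare4-10511's sector: KOU's Akbulut-cork PALF `k = 5`, the
`(P₅, φ₀)` pair of Disproof §13c, the 324 T6 spheres of §13d). ENGINE available: the bridge-trisection
lift in degree `d` (a `(b; cᵢ)`-bridge trisection of `F` w.r.t. the genus-0 trisection of `S⁴` lifts to a
trisection of `M` of genus `b − d + 1`: the `d`-fold simple cover of `B³` along `b` trivial arcs is a
handlebody of Euler characteristic `d − b`), so `b(F) ≤ d + 1 ⇒ M ≅ S⁴` by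
`mz_genus_le_two_homotopySphere_gk`; and low braid index ⇒ ribbon ⇒ doubles (3717) as in Stub 2. No
engine beyond these (triage r2-1/r2-3: "K3 has no complexity engine") — shared territory with the
word-calculus line `hurwitz-deletion-presentation` (stable signed-Hurwitz nullity acts on exactly these
sorted factorisations, all genera). IMPLIED BY SPC4 (Disproof §1 shape), only provable; `M ≃ₕ S⁴`
load-bearing (`D(B_{p,q})`, `π₁ = ℤ/p`, descends to a sorted cover by Stub 1 applied to its trivial
double bisection). For `d ≥ 5` and WITHOUT the sorted/acyclic clauses this would be SPC4 itself modulo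
Iori–Piergallini (every closed oriented 4-manifold is a simple 5-fold cover of `S⁴` along an embedded
surface; orientability of the branch surface = Kirby Problem 4.113, = the sibling line's open
`stub_orientableBranchedCover`) — the clauses keep it the honest image of THIS crux. Size: open-problem.
Sources: arXiv:math/0002042 Thm 2.2 / Prop 1.2; doi:10.2140/gt.2002.6.393 (Iori–Piergallini);
doi:10.1016/0040-9383(94)00034-i (Piergallini 1995); arXiv:1602.07459; arXiv:1507.08370; arXiv:1410.8133;
arXiv:1607.07661 Prop 2.3. -/
theorem stub_sortedCoverStandard :
    ∀ (M : Type) [TopologicalSpace M] [T2Space M] [SecondCountableTopology M]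
      [ChartedSpace (𝔼 4) M] [IsManifold (𝓡 4) ∞ M],
      M ≃ₕ 𝕊⁴ →
    ∀ (S : Type) [TopologicalSpace S] [T2Space S] [SecondCountableTopology S] [CompactSpace S]
      [ChartedSpace (𝔼 2) S] [IsManifold (𝓡 2) ∞ S]
      (f : S → 𝕊⁴) (ν : S × ℂ → 𝕊⁴) (σ : S × ℂ → M) (p : M → 𝕊⁴) (d : ℕ),
      3 ≤ d → IsSimpleBranchedCover f ν σ p d → IsSortedClosedSurfaceBraid S f →
      (∀ k : ℕ, 0 < k →
        IsZero (singularHomology ℚ ℚ ↥(p ⁻¹' SurfaceBraid.northBall) k) ∧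
        IsZero (singularHomology ℚ ℚ ↥(p ⁻¹' SurfaceBraid.southBall) k)) →
      Nonempty (M ≃ₘ⟮𝓡 4, 𝓡 4⟯ 𝕊⁴) := by
  sorry

/-! ## Composition (kernel-checked, no `sorry` of its own): the crux BY NAME from the stubs -/

/-- **CRUX FROM THE LINE: `ConvexBisection.AcyclicBisectionRigidity` (stmt-SmoothPoincare4-10507).**
Unpack the acyclic bisection of `M ≃ₕ S⁴`; `M` is compact (tree theorem
`compactSpace_of_homotopyEquiv_sphere_four_holds`) and nonempty (a point of `S⁴` pulled back along the
homotopy inverse); DESCEND (Stub 1) to a sorted simple branched cover `p : M → S⁴` of degree `d ≥ 1` with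
the halves as hemisphere preimages; then `d = 1`: `p` is a diffeomorphism
(`nonempty_diffeomorph_of_degree_one`, proved); `d = 2`: the target (Stub 2); `d ≥ 3`: transport the
ℚ-acyclicity of `Wᵢ` to `p⁻¹(B_±)` along the homeomorphisms `Wᵢ ≃ₜ range eᵢ = p⁻¹(B_±)`
(`IsEmbedding.toHomeomorph`, `Homeomorph.setCongr`, `singularHomology.mapIso`) and apply the residual
(Stub 3). `M ≃ₕ S⁴` is consumed four times (compactness, non-emptiness, Stub 2, Stub 3), honouring
Disproof's `false_without_homotopyEquiv`. -/
theorem AcyclicBisectionRigidity_of : ConvexBisection.AcyclicBisectionRigidity := by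
  intro M _ _ _ _ _ e hb
  obtain ⟨W₁, _, _, _, _, W₂, _, _, _, _, J₁, J₂, e₁, e₂, he₁, he₂, hcover, hseam₁, hseam₂, hξ, hac⟩ := hb
  haveI : CompactSpace M :=
    Literature.Topology.FourManifolds.compactSpace_of_homotopyEquiv_sphere_four_holds M e
  haveI : Nonempty M := ⟨e.invFun northPole⟩
  obtain ⟨d, S, _, _, _, _, _, _, f, ν, σ, p, hd, hcov, hsort, hr₁, hr₂⟩ :=
    stub_braidDescent M W₁ W₂ J₁ J₂ e₁ e₂ he₁ he₂ hcover hseam₁ hseam₂ hξ hac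
  rcases Nat.lt_or_ge d 3 with hlt | hge
  · -- degrees 1 and 2
    obtain rfl | rfl : d = 1 ∨ d = 2 := by omega
    · exact nonempty_diffeomorph_of_degree_one hcov
    · exact stub_twoKnotBranchedDoubleStandard M e S f ν σ p hcov
  · -- degree ≥ 3: transport acyclicity to the hemisphere preimages, then the residual
    have E₁ : W₁ ≃ₜ ↥(p ⁻¹' SurfaceBraid.northBall) :=
      he₁.isEmbedding.toHomeomorph.trans (Homeomorph.setCongr hr₁)
    have E₂ : W₂ ≃ₜ ↥(p ⁻¹' SurfaceBraid.southBall) :=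
      he₂.isEmbedding.toHomeomorph.trans (Homeomorph.setCongr hr₂)
    refine stub_sortedCoverStandard M e S f ν σ p d hge hcov hsort fun k hk => ⟨?_, ?_⟩
    · exact (hac k hk).1.of_iso (singularHomology.mapIso ℚ ℚ E₁.symm k)
    · exact (hac k hk).2.of_iso (singularHomology.mapIso ℚ ℚ E₂.symm k)

/-! ## Cross-links (sorry-free): the two recognisers are SPC4-shielded, the lever is not -/

/-- **Stub 2 is implied by the summit** (it has the shielded shape `∀ M ≃ₕ S⁴, P M → M ≅ S⁴` of
Disproof §1 `shielded_of_spc4`): a refutation of the target is an exotic `S⁴` carrying an involution with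
quotient `S⁴`, nothing cheaper. Recorded so that refuters spend their budget on Stub 1. -/
theorem twoKnotBranchedDoubleStandard_of_spc4 (h : SmoothPoincare4) :
    ∀ (M : Type) [TopologicalSpace M] [T2Space M] [SecondCountableTopology M]
      [ChartedSpace (𝔼 4) M] [IsManifold (𝓡 4) ∞ M],
      M ≃ₕ 𝕊⁴ →
    ∀ (S : Type) [TopologicalSpace S] [T2Space S] [SecondCountableTopology S] [CompactSpace S]
      [ChartedSpace (𝔼 2) S] [IsManifold (𝓡 2) ∞ S]
      (f : S → 𝕊⁴) (ν : S × ℂ → 𝕊⁴) (σ : S × ℂ → M) (p : M → 𝕊⁴),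
      IsSimpleBranchedCover f ν σ p 2 →
      Nonempty (M ≃ₘ⟮𝓡 4, 𝓡 4⟯ 𝕊⁴) := by
  intro M _ _ _ _ _ e S _ _ _ _ _ _ f ν σ p _
  exact h M inferInstance inferInstance e

/-- **Stub 3 is implied by the summit** (same shielded shape). -/
theorem sortedCoverStandard_of_spc4 (h : SmoothPoincare4) :
    ∀ (M : Type) [TopologicalSpace M] [T2Space M] [SecondCountableTopology M]
      [ChartedSpace (𝔼 4) M] [IsManifold (𝓡 4) ∞ M],
      M ≃ₕ 𝕊⁴ →
    ∀ (S : Type) [TopologicalSpace S] [T2Space S] [SecondCountableTopology S] [CompactSpace S]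
      [ChartedSpace (𝔼 2) S] [IsManifold (𝓡 2) ∞ S]
      (f : S → 𝕊⁴) (ν : S × ℂ → 𝕊⁴) (σ : S × ℂ → M) (p : M → 𝕊⁴) (d : ℕ),
      3 ≤ d → IsSimpleBranchedCover f ν σ p d → IsSortedClosedSurfaceBraid S f →
      (∀ k : ℕ, 0 < k →
        IsZero (singularHomology ℚ ℚ ↥(p ⁻¹' SurfaceBraid.northBall) k) ∧
        IsZero (singularHomology ℚ ℚ ↥(p ⁻¹' SurfaceBraid.southBall) k)) →
      Nonempty (M ≃ₘ⟮𝓡 4, 𝓡 4⟯ 𝕊⁴) := by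
  intro M _ _ _ _ _ e S _ _ _ _ _ _ f ν σ p d _ _ _ _
  exact h M inferInstance inferInstance e

end Summit.SmoothPoincare4.SmoothPoincare4.Cruxes.AcyclicBisectionRigidity.BranchTwoKnotQuotient

end
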